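import Summits.QuantumFields.YangMills.Theorems.BalabanUVNodesN20BankedTerminalTerm
import Summits.QuantumFields.YangMills.Theorems.BalabanUVNodesN20FinalLevelBankedBudget

/-!
# N20 (NE7b), ITEM (c) INTERIOR: FROM THE BANKED HISTORY TO THE PER-RECORD PRICE — (1.80)⁺ of [LF-II] pp. 384–387 with PER-EVENT banked credits
# `t = t₀ + Σ_{e ∈ record} p_e` (scale-attached, variable), the horizon factor `≤ e^{−P}·e^{−t₀}·Π_e e^{−p_e}`, the per-event split «credit ≥ κ₁·window + margin»
# ⇒ print's VARIABLE-WINDOW price shape for ONE component, and the per-RECORD price `y` of `…N20FinalLevelBankedBudget.sum_stock_le_twoRate_of_records` DERIVED as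
# the fibre sum of per-COMPONENT prices times a displayed multiplicity — the clauses `hfile ∧ hy` of the records face (`…CoPHKRatioDominationBankedRecords`) discharged
# down to a per-component factor letter and an entropy count

Cell `pub-ymgap`, YM-PLAN Track A (HUMAN RULING D-0062); seat `pub-ymgap-dag-n20-d` (R134 (a) N20 NE7b s3 «W_K < 1, Σ W_K < ∞ from [B16] (1.79)–(1.89) pp. 383–387 directly»), gen 41 —
inside director-ym №374 line (E) ∕ item (c) («the banking budget algebra typed ABSTRACTLY against `B16Improved189FullBudget*` ∕ `T4PersistentHistoryCount` …»; road [e] TOWER-FREE of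
record, №377).  `--kind proof --supports stmt-QuantumFields-27366 --as helper` (K3⁸); COUNT-NEUTRAL; THEOREMS ONLY (0 `def`).  [LF-II] = [Balaban1989LargeFieldII]; [III] =
[Balaban1988Convergent].  Companions BY NAME: `…N20BankedTerminalTerm` (gen 40, p771946 + v1.1 p773313: `resetT_banked`, `bankedFactor_le`), `B16Improved189FullBudget.{mergeT_controls,
controlsT_zero_iff, invariantT_all}`, `…N20FinalLevelBankedBudget.sum_stock_le_twoRate_of_records` (gen 40, p771116), `T4PersistentHistoryCount.{records, mem_records,
credit_dominates_window, p0Profile}`.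

WHY.  Gen 40 closed item (c) in two currencies that did not yet meet: `…N20BankedTerminalTerm` runs the cell's banking THROUGH print's induction with a UNIFORM credit `p` per event
(`t = t₀ + p·m`, horizon factor `e^{−P}·e^{−t₀}·ρ^m`, `ρ = e^{−p}` — the uniform-window price), while the K-UNIFORM statement-of-record candidate `…CoPHKRatioDominationBankedRecords`
(✓p773984) consumes print's VARIABLE windows: a per-RECORD price `y σ j z b Q ≤ ρ_b·e^{−κ₁W_b}·Π_{e∈Q}(e^{−κ₁W_e}·η_e)` over `T4PersistentHistoryCount.records` (each event's credit split as
`κ₁ ×` the window it pays for, times a residual), displayed there as the hypotheses `hfile ∧ hy` («(R1) the per-record prices — the cell's BANKING»).  Print's windows creep toward the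
ultraviolet along the run (`R_j` of (2.5) [III]; [LF-II] p. 386 renewal «K = R_{j+1}», p. 387 merger «K ≤ K₂ + n₁ + R_{j+1}»), so the credit banked at an event must be attached to the
event's OWN scale — `p_e = c·p₀(g_{s_e})`, dominating `κ₁·W_e + E` by `T4PersistentHistoryCount.credit_dominates_window` (K-uniformly, one γ-clause on the infrared coupling).  THIS FILE
(1) re-runs (1.80)⁺ with the banked term `t₀ + B`, `B` = an arbitrary banked SUM, sub-additive at a merger with overshoot = the new event's credit and growing by the new event's credit at a
renewal (for `B = Σ_{e ∈ record} p_e` this is «one new event per merger ∕ renewal», §1) — `mergeT_controls` BY NAME; the reset is gen 40's `resetT_banked` verbatim (its `p` was already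
free); (2) reads the horizon: `F ≤ e^{−P}·e^{−t₀}·e^{−B} = e^{−P}·e^{−t₀}·Π_{e∈Q} e^{−p_e}` (§2); (3) splits every credit, `κ₁·W_e + m_e ≤ p_e`, and the birth term, `κ₁·W_b + P₀ ≤ P`
⇒ `F ≤ (e^{−P₀}e^{−t₀})·e^{−κ₁W_b}·Π_{e∈Q}(e^{−κ₁W_e}·e^{−m_e})` = the price shape of `T4PersistentHistoryCount.slotPrice_le` for ONE component, with the credits supplied along the flow
by `credit_dominates_window` (§3); (4) files the components of a stock under (birth slot, birth kind, record) and DEFINES NOTHING: the per-record price is the fibre sum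
`y j z b Q := Σ_{Y : slot Y = ⟨j,z⟩, kind Y = b, rec Y = Q} x Y`, for which `hfile` holds with EQUALITY (`slotFibre_sum_eq`) and `hy` follows from the per-component price and a
multiplicity `#fibre ≤ n_b·Π_{e∈Q} n_e` with `ρ_b ↦ n_b·ρ_b`, `η_e := n_e·μ_e` (§4); (5) composes with `sum_stock_le_twoRate_of_records`: the two-rate stock budget
`Σ_{Y ∈ Old} x Y ≤ ρ̄e^{−κ₁}·V·(Λσ)^{K−j⋆+1}∕(1−Λσ)`, `σ = e^{η̄−κ₁}`, from PER-COMPONENT prices, the filing maps and the multiplicity (§5).  After this file the (R1)-hypothesis of the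
records face reads: per removed component, a factor letter of §3's OUTPUT shape (what (1.80)⁺ with banked scale-attached credits yields for print's p. 384 factor) + the entropy count (ID).

WHAT IS PROVED (kernel arithmetic over the bookkeeping model of `Step.Budget`; finite sums; zero `sorry`; companions BY NAME).
§1 `bankedSum_sub`, `recordCredit_sub_of_oneNewEvent` (`rec T ⊆ insert e (rec x ∪ rec Y)`, `p ≥ 0` ⇒ `Σ_{rec T} p ≤ Σ_{rec x} p + Σ_{rec Y} p + p e`), ★★ `mergeT_controls_bankedSum`
   ((1.85)–(1.88) with `t₀ + B`: `hbudget : E + (E_t + p_new) + D ≤ q`), ★ `resetT_bankedSum` (p. 386 KEEPING `κ_j(Z₀)`, banking the new event's `p_new`: `resetT_banked` re-split).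
§2 ★★ `bankedFactor_le_exp` (`K = 0`: `F ≤ e^{−P}·e^{−t₀}·e^{−B}`), ★★ `bankedFactor_le_prod` (`B = Σ_{e∈Q} p_e`), ★★★ `bankedFactor_le_prod_of_history` (`invariantT_all` ∘ §2;
   uniform credits `p_e ≡ p` recover gen 40's `ρ^{#Q}` by `Finset.prod_const`).
§3 `prod_exp_neg_le_of_credits`, `exp_neg_le_of_birthCredit`, ★★ `componentPrice_of_bankedFactor`, ★★★ `componentPrice_of_bankedHistory` (ONE component's price in `slotPrice_le`'s
   shape from its banked (1.80)⁺ history), ★★ `eventCredits_of_flow` (the split `κ₁·W_e + E ≤ p_e` at every event from `credit_dominates_window`: events at scales `s_e ≤ K`, windows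
   `W_e ≤ W(s_e) ≤ (1+F)R_{s_e}`, credits `p_e ≥ c·p₀(g_{s_e})`, ONE γ-clause on `g_K`).
§4 ★★ `slotFibre_sum_eq` (`hfile` with EQUALITY for the fibre-sum price), ★★ `recordPrice_le_of_componentPrices` (`hy` from per-component prices × multiplicity).
§5 ★★★ `sum_stock_le_twoRate_of_componentPrices` (the stock budget of `sum_stock_le_twoRate_of_records` from per-COMPONENT prices, filing maps `kind`∕`rec`, multiplicities `n_b`, `n_e`).
§6 ★ `toy_componentPrice` (NON-VACUITY of §2–§3: one component, budget `6`, size term `1`, one event with credit `3 ≥ 2·1 + 1`, birth `4 ≥ 2·1 + 2`; the price fires with every factor visible).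

HONEST FRAMING.  [bookkeeping] + [folklore].  Components, budgets, profiles, horizons, terminal terms, records, windows, credits, filing maps and multiplicities are abstract data; the
binders (`hB`, `htsub₀`, `hbudget`, `hsmall`, the factor form `hF`, the splits `hb`∕`he`, `hkind`∕`hrec`∕`hcard`) are displayed hypotheses exactly as print's located conditions are in
`B16Improved189FullBudget`.  The BANKING itself (keeping `κ_j(Z₀)` at a reset, charging `p_e` to the slacks of (1.88) ∕ p. 386) is the cell's R1 and is NOT PRINTED ([LF-II] spends both
credits); which scale's credit pays which event's window (renewal: credit `p₀(g_j)`, window `R_{j+1}`; merger: surplus `2(1+β₀)⁻¹p₀(g_{j+1})`, window `K₂ + n₁ + R_{j+1}`) and the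
identification of (`ε`, `W`, `kind`, `rec`, `n`) with print's events ∕ windows ∕ fatness classes ∕ admissible-sequence entropies are READING (ID) of `T4PersistentHistoryCount`, NOT here;
that the p. 384 factor `exp(−κ_k(X) − 2p₀(g_{j(X)}))` bounds [IV] (0.3)'s fibre ratio of a removed component is the ESTIMATE (a) (junction NC-NE7b-α, UNRULED), NOT here; the removal ∕
filing structure on def-T's `SeqOfRecord` is the DEFINER object (b), NOT here.  NO inequality of Bałaban's is asserted; NE7 ∕ NE7b ∕ NE7c NOT PRINTED for `d = 4` ∕ NOT proved; N20 NOT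
discharged; counts UNMOVED (typed 28∕28 · discharged 8∕27); one finite four-torus programme at fixed `ε` — NOT ℝ⁴, NOT OS, NOT a mass gap, NOT the Clay problem.  No `def`, no `instance`,
no `notation`, no `sorry`; no decl below carries a cite tag.
-/

open Finset
open scoped BigOperators

namespace YMDAG.UVSplit

open Literature.MathematicalPhysics.QuantumFieldTheory.Balaban1983to89
open Literature.MathematicalPhysics.QuantumFieldTheory.Balaban1983to89.Step
open Literature.MathematicalPhysics.QuantumFieldTheory.Balaban1983to89.Step.Budget
open Literature.MathematicalPhysics.QuantumFieldTheory.Balaban1983to89.B16Improved189FullBudget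
open T4PersistentHistoryCount (records mem_records credit_dominates_window)

/-! ## §1 (1.80)⁺ with a banked SUM of per-event credits: merger and reset -/

section Cases

/-- **TERMINAL SUB-ADDITIVITY OF `t₀ + B` AT A SPLIT**: the size part sub-additive with overshoot `E_t` (`B16Improved189FullBudget`'s `htsub`) and the banked sum sub-additive with
overshoot `p_new` (the ONE new event's credit) ⇒ `t₀ + B` sub-additive with overshoot `E_t + p_new`.  Gen 40's `bankedT_sub` is the case `B = p·m`, `p_new = p`. [bookkeeping] -/
theorem bankedSum_sub {tT tx tY Et BT Bx BY pnew : ℝ} (htsub : tT ≤ tx + tY + Et) (hB : BT ≤ Bx + BY + pnew) :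
    tT + BT ≤ (tx + Bx) + (tY + BY) + (Et + pnew) := by
  linarith

/-- **THE RECORD-LEVEL ORIGIN OF `hB`**: if the merged component's record lies in the two pieces' records plus ONE new event `e` ([LF-II] p. 387: the merger is one renormalization
event of the genealogy) and the credits are non-negative, then `Σ_{rec T} p ≤ Σ_{rec x} p + Σ_{rec Y} p + p e`. [folklore] -/
theorem recordCredit_sub_of_oneNewEvent {ε : Type*} [DecidableEq ε] {QT Qx QY : Finset ε} {e : ε} (p : ε → ℝ)
    (hpx : ∀ e' ∈ Qx, 0 ≤ p e') (hpY : ∀ e' ∈ QY, 0 ≤ p e') (hpe : 0 ≤ p e) (hQ : QT ⊆ insert e (Qx ∪ QY)) :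
    ∑ e' ∈ QT, p e' ≤ ∑ e' ∈ Qx, p e' + ∑ e' ∈ QY, p e' + p e := by
  have hU : ∀ e' ∈ Qx ∪ QY, 0 ≤ p e' := fun e' he' => by
    rcases Finset.mem_union.1 he' with h | h
    · exact hpx e' h
    · exact hpY e' h
  have hI : ∀ e' ∈ insert e (Qx ∪ QY), 0 ≤ p e' := fun e' he' => by
    rcases Finset.mem_insert.1 he' with rfl | h
    · exact hpe
    · exact hU e' h
  have h1 : ∑ e' ∈ QT, p e' ≤ ∑ e' ∈ insert e (Qx ∪ QY), p e' :=
    Finset.sum_le_sum_of_subset_of_nonneg hQ fun e' he' _ => hI e' he'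
  have h2 : ∑ e' ∈ insert e (Qx ∪ QY), p e' ≤ p e + ∑ e' ∈ Qx ∪ QY, p e' := by
    by_cases he : e ∈ Qx ∪ QY
    · rw [Finset.insert_eq_of_mem he]; linarith
    · rw [Finset.sum_insert he]
  have h3 : ∑ e' ∈ Qx ∪ QY, p e' ≤ ∑ e' ∈ Qx, p e' + ∑ e' ∈ QY, p e' := by
    rw [← Finset.sum_union_inter]
    linarith [Finset.sum_nonneg fun e' (he' : e' ∈ Qx ∩ QY) => hpx e' (Finset.mem_inter.1 he').1]
  linarith

/-- ★★ **THE MERGER (1.85)–(1.88) WITH THE BANKED SUM** (`mergeT_controls` BY NAME at the overshoot `E_t + p_new`): pieces `ι` with contributions, family functions `cost`, `P`, `rhs`, a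
size term `t₀` and a BANKED SUM `B` on sub-families (sub-additive with overshoot `p_new` at every split — `hB`, e.g. `recordCredit_sub_of_oneNewEvent`), connectedness with the endpoint
property, the single-piece base for `rhs + (t₀ + B)`, print's split binders `hP ∕ hc ∕ hsub`, the size sub-additivity `htsub₀` with overshoot `E_t`, and the located condition SHIFTED BY
THE NEW EVENT'S CREDIT, `E + (E_t + p_new) + D ≤ q` ⇒ (1.80)⁺ at scale `j+1` for the merged component with the terminal term `t₀(S) + B(S)`.  Banking `p_new` at a merger is admissible
exactly when it fits in the slack of (1.88); gen 40's `mergeT_controls_banked` is the case `B = p·m`. [bookkeeping] -/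
theorem mergeT_controls_bankedSum (b : Budget.Consts) (j : ℕ) {ι : Type*} [DecidableEq ι] (contrib : ι → ℝ)
    (cost P rhs t₀ B : Finset ι → ℝ) (S : Finset ι) (hne : S.Nonempty) (Conn : Finset ι → Prop) (hconn : Conn S)
    (q E Et D pnew : ℝ)
    (hleaf : ∀ T, T ⊆ S → Conn T → 2 ≤ T.card → ∃ x ∈ T, Conn (T.erase x))
    (hsingle : ∀ x ∈ S, rhs {x} + (t₀ {x} + B {x}) ≤ merge contrib {x} (cost {x}) (P {x}))
    (hP : ∀ T x, T ⊆ S → x ∈ T → 2 ≤ T.card → q ≤ P {x} + P (T.erase x) - P T)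
    (hc : ∀ T x, T ⊆ S → x ∈ T → 2 ≤ T.card → Conn T → Conn (T.erase x) → cost T ≤ cost {x} + cost (T.erase x) + D)
    (hsub : ∀ T x, T ⊆ S → x ∈ T → 2 ≤ T.card → Conn T → Conn (T.erase x) → rhs T ≤ rhs {x} + rhs (T.erase x) + E)
    (htsub₀ : ∀ T x, T ⊆ S → x ∈ T → 2 ≤ T.card → Conn T → Conn (T.erase x) → t₀ T ≤ t₀ {x} + t₀ (T.erase x) + Et)
    (hB : ∀ T x, T ⊆ S → x ∈ T → 2 ≤ T.card → Conn T → Conn (T.erase x) → B T ≤ B {x} + B (T.erase x) + pnew)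
    (hbudget : E + (Et + pnew) + D ≤ q)
    (K : ℕ) (size : ℕ → ℝ) (κZ tZ : ℝ)
    (hrhsZ : ∑ n ∈ Finset.Ioc (j + 1) (j + 1 + K), b.cost n (size n) ≤ rhs S) (htZ : tZ ≤ t₀ S + B S)
    (hκZ : merge contrib S (cost S) (P S) ≤ κZ) :
    Controls b (j + 1) K (κZ - tZ) size :=
  mergeT_controls b j contrib cost P rhs (fun T => t₀ T + B T) S hne Conn hconn q E (Et + pnew) D hleaf hsingle hP hc hsub
    (fun T x hT hx h2 hC hC' => bankedSum_sub (htsub₀ T x hT hx h2 hC hC') (hB T x hT hx h2 hC hC')) hbudget K size κZ tZ hrhsZ htZ hκZ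

/-- ★ **THE BANKED RESET WITH THE BANKED SUM** (p. 386, ONE new event `e` with credit `p_new`; gen 40's `resetT_banked` re-split): from (1.80)⁺ at scale `j` for `Z₀` with the term
`t₀ + B_old` (costs `≥ 0`, any horizon) and the smallness of p. 386 charged with the new size term AND the new event's credit, `Σ_{n=j+1}^{j+1+K′} cost + t₀′ + p_new ≤ p_fresh`, (1.80)⁺ at
scale `j+1` for the budget `κ₀ + p_fresh − cost_{j+1}` and the term `(t₀ + t₀′) + (B_old + p_new)` — the banked sum grows by exactly the new event's credit.  The cell's R1 at a renewal;
NOT PRINTED. [bookkeeping] -/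
theorem resetT_bankedSum (b : Budget.Consts) (j K K' : ℕ) {κ₀ t₀ Bold pfresh t₀' pnew : ℝ} (s₀ s : ℕ → ℝ)
    (hcost : ∀ n ∈ Finset.Ioc j (j + K), 0 ≤ b.cost n (s₀ n)) (hold : Controls b j K (κ₀ - (t₀ + Bold)) s₀)
    (hsmall : ∑ n ∈ Finset.Ioc j (j + 1 + K'), b.cost n (s n) + t₀' + pnew ≤ pfresh) :
    Controls b (j + 1) K' (κ₀ + pfresh - b.cost (j + 1) (s (j + 1)) - ((t₀ + t₀') + (Bold + pnew))) s := by
  have h := resetT_banked b j K K' s₀ s hcost hold hsmall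
  have e : t₀ + Bold + t₀' + pnew = (t₀ + t₀') + (Bold + pnew) := by ring
  rw [e] at h
  exact h

end Cases

/-! ## §2 At the horizon: every banked event comes out of the factor -/

section Horizon

/-- ★★ **THE BANKED FACTOR AT THE HORIZON, BANKED SUM**: `K = 0` under (1.80)⁺ with the term `t₀ + B` gives `t₀ + B ≤ κ` (`controlsT_zero_iff`); with the factor form of p. 384,
`F ≤ exp(−κ − P)`, the factor is `≤ exp(−P)·exp(−t₀)·exp(−B)`. [bookkeeping] -/
theorem bankedFactor_le_exp (b : Budget.Consts) (k : ℕ) {κ t₀ B P F : ℝ} (s : ℕ → ℝ)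
    (hC : Controls b k 0 (κ - (t₀ + B)) s) (hF : F ≤ Real.exp (-κ - P)) :
    F ≤ Real.exp (-P) * Real.exp (-t₀) * Real.exp (-B) := by
  have ht : t₀ + B ≤ κ := (controlsT_zero_iff b k κ (t₀ + B) s).mp hC
  rw [← Real.exp_add, ← Real.exp_add]
  exact hF.trans (Real.exp_le_exp.2 (by linarith))

/-- ★★ **… WITH THE CREDITS OF THE RECORD VISIBLE ONE BY ONE**: `B = Σ_{e ∈ Q} p_e` ⇒ `F ≤ exp(−P)·exp(−t₀)·Π_{e ∈ Q} exp(−p_e)`. [bookkeeping] -/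
theorem bankedFactor_le_prod {ε : Type*} (b : Budget.Consts) (k : ℕ) {κ t₀ P F : ℝ} (Q : Finset ε) (p : ε → ℝ) (s : ℕ → ℝ)
    (hC : Controls b k 0 (κ - (t₀ + ∑ e ∈ Q, p e)) s) (hF : F ≤ Real.exp (-κ - P)) :
    F ≤ Real.exp (-P) * Real.exp (-t₀) * ∏ e ∈ Q, Real.exp (-p e) := by
  have h := bankedFactor_le_exp b k s hC hF
  rwa [← Finset.sum_neg_distrib, Real.exp_sum] at h

/-- ★★★ **… FROM A BANKED HISTORY** (`invariantT_all` ∘ `bankedFactor_le_prod`): (1.80)⁺ with terminal terms `t j` at a first scale `j₀` and a step at every scale (assembled by the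
consumer from `bornT_controls` ∕ `case1T_183` ∕ `resetT_bankedSum` ∕ `mergeT_controls_bankedSum`), a horizon-`0` component `X` of `Z_k` whose term dominates `t₀ + Σ_{e∈Q} p_e`
(`Q` = its record, `p_e` = the credit banked at event `e`), and the factor form `F ≤ exp(−κ_k(X) − P)` ⇒ `F ≤ exp(−P)·exp(−t₀)·Π_{e∈Q} exp(−p_e)`. [bookkeeping] -/
theorem bankedFactor_le_prod_of_history (b : Budget.Consts) (D : (j : ℕ) → ScaleData j) (t : (j : ℕ) → (D j).Comp → ℝ) (j₀ : ℕ)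
    (hbase : ∀ Z, Controls b j₀ ((D j₀).K Z) ((D j₀).κ Z - t j₀ Z) ((D j₀).size Z))
    (hstep : ∀ j, j₀ ≤ j → (∀ Z, Controls b j ((D j).K Z) ((D j).κ Z - t j Z) ((D j).size Z)) →
      ∀ Z, Controls b (j + 1) ((D (j + 1)).K Z) ((D (j + 1)).κ Z - t (j + 1) Z) ((D (j + 1)).size Z))
    {k : ℕ} (hk : j₀ ≤ k) (X : (D k).Comp) (hK : (D k).K X = 0) {ε : Type*} (Q : Finset ε) (p : ε → ℝ) {t₀ P F : ℝ}
    (ht : t₀ + ∑ e ∈ Q, p e ≤ t k X) (hF : F ≤ Real.exp (-(D k).κ X - P)) :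
    F ≤ Real.exp (-P) * Real.exp (-t₀) * ∏ e ∈ Q, Real.exp (-p e) := by
  have hall := invariantT_all b D t j₀ hbase hstep k hk X
  rw [hK] at hall
  have hle : t k X ≤ (D k).κ X := (controlsT_zero_iff b k ((D k).κ X) (t k X) ((D k).size X)).mp hall
  have hC : Controls b k 0 ((D k).κ X - (t₀ + ∑ e ∈ Q, p e)) ((D k).size X) :=
    (controlsT_zero_iff b k ((D k).κ X) (t₀ + ∑ e ∈ Q, p e) ((D k).size X)).mpr (ht.trans hle)
  exact bankedFactor_le_prod b k Q p ((D k).size X) hC hF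

end Horizon

/-! ## §3 The per-event split «credit ≥ κ₁·window + margin» and the price of ONE component in print's variable-window shape -/

section Split

/-- **SPLITTING THE EVENT CREDITS**: `κ₁·W_e + m_e ≤ p_e` at every event of the record ⇒ `Π_{e∈Q} exp(−p_e) ≤ Π_{e∈Q} (exp(−κ₁W_e)·exp(−m_e))`. [folklore] -/
theorem prod_exp_neg_le_of_credits {ε : Type*} (Q : Finset ε) {p m : ε → ℝ} {Wn : ε → ℕ} {κ₁ : ℝ}
    (h : ∀ e ∈ Q, κ₁ * Wn e + m e ≤ p e) :
    ∏ e ∈ Q, Real.exp (-p e) ≤ ∏ e ∈ Q, (Real.exp (-(κ₁ * Wn e)) * Real.exp (-m e)) := by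
  refine Finset.prod_le_prod (fun e _ => (Real.exp_pos _).le) fun e he => ?_
  rw [← Real.exp_add]
  exact Real.exp_le_exp.2 (by linarith [h e he])

/-- **SPLITTING THE BIRTH TERM**: `κ₁·W_b + P₀ ≤ P` ⇒ `exp(−P) ≤ exp(−P₀)·exp(−κ₁W_b)` (the birth factors pay the birth window, [LF-II] p. 385 «K ≤ n₀ − j + R_j»). [folklore] -/
theorem exp_neg_le_of_birthCredit {P P₀ κ₁ : ℝ} {Wb : ℕ} (h : κ₁ * Wb + P₀ ≤ P) :
    Real.exp (-P) ≤ Real.exp (-P₀) * Real.exp (-(κ₁ * Wb)) := by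
  rw [← Real.exp_add]
  exact Real.exp_le_exp.2 (by linarith)

/-- ★★ **THE PRICE OF ONE COMPONENT IN PRINT'S VARIABLE-WINDOW SHAPE**: the horizon factor `F ≤ exp(−P)·exp(−t₀)·Π_{e∈Q} exp(−p_e)` (§2) with the splits `κ₁·W_b + P₀ ≤ P` (birth) and
`κ₁·W_e + m_e ≤ p_e` (events) ⇒ `F ≤ (exp(−P₀)·exp(−t₀))·exp(−κ₁W_b)·Π_{e∈Q}(exp(−κ₁W_e)·exp(−m_e))` — `T4PersistentHistoryCount.slotPrice_le`'s price shape for ONE structure with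
`ρ_b = exp(−P₀)·exp(−t₀)` and `η_e = exp(−m_e)`. [bookkeeping] -/
theorem componentPrice_of_bankedFactor {ε : Type*} (Q : Finset ε) {F P P₀ t₀ κ₁ : ℝ} {p m : ε → ℝ} {Wn : ε → ℕ} {bk : ε}
    (hF : F ≤ Real.exp (-P) * Real.exp (-t₀) * ∏ e ∈ Q, Real.exp (-p e)) (hb : κ₁ * Wn bk + P₀ ≤ P)
    (he : ∀ e ∈ Q, κ₁ * Wn e + m e ≤ p e) :
    F ≤ Real.exp (-P₀) * Real.exp (-t₀) * Real.exp (-(κ₁ * Wn bk)) * ∏ e ∈ Q, (Real.exp (-(κ₁ * Wn e)) * Real.exp (-m e)) := by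
  have h1 := exp_neg_le_of_birthCredit hb
  have h2 := prod_exp_neg_le_of_credits Q he
  have hprod0 : 0 ≤ ∏ e ∈ Q, Real.exp (-p e) := Finset.prod_nonneg fun e _ => (Real.exp_pos _).le
  calc F ≤ Real.exp (-P) * Real.exp (-t₀) * ∏ e ∈ Q, Real.exp (-p e) := hF
    _ ≤ Real.exp (-P₀) * Real.exp (-(κ₁ * Wn bk)) * Real.exp (-t₀) * ∏ e ∈ Q, Real.exp (-p e) :=
        mul_le_mul_of_nonneg_right (mul_le_mul_of_nonneg_right h1 (Real.exp_pos _).le) hprod0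
    _ ≤ Real.exp (-P₀) * Real.exp (-(κ₁ * Wn bk)) * Real.exp (-t₀) * ∏ e ∈ Q, (Real.exp (-(κ₁ * Wn e)) * Real.exp (-m e)) :=
        mul_le_mul_of_nonneg_left h2 (by positivity)
    _ = Real.exp (-P₀) * Real.exp (-t₀) * Real.exp (-(κ₁ * Wn bk)) * ∏ e ∈ Q, (Real.exp (-(κ₁ * Wn e)) * Real.exp (-m e)) := by ring

/-- ★★★ **THE PRICE OF ONE COMPONENT FROM ITS BANKED HISTORY**: (1.80)⁺ along the genealogy (base + steps), horizon `0`, the term dominating `t₀ + Σ_{e∈Q} p_e`, the p. 384 factor form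
`F ≤ exp(−κ_k(X) − P)`, the birth split `κ₁·W_b + P₀ ≤ P` and the event splits `κ₁·W_e + m_e ≤ p_e` ⇒ `F ≤ (exp(−P₀)exp(−t₀))·exp(−κ₁W_b)·Π_{e∈Q}(exp(−κ₁W_e)·exp(−m_e))` — the
per-COMPONENT price hypothesis `hx` of §5 with `ρ (kind) = exp(−P₀)·exp(−t₀)`, `μ e = exp(−m_e)`. [bookkeeping] -/
theorem componentPrice_of_bankedHistory (b : Budget.Consts) (D : (j : ℕ) → ScaleData j) (t : (j : ℕ) → (D j).Comp → ℝ) (j₀ : ℕ)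
    (hbase : ∀ Z, Controls b j₀ ((D j₀).K Z) ((D j₀).κ Z - t j₀ Z) ((D j₀).size Z))
    (hstep : ∀ j, j₀ ≤ j → (∀ Z, Controls b j ((D j).K Z) ((D j).κ Z - t j Z) ((D j).size Z)) →
      ∀ Z, Controls b (j + 1) ((D (j + 1)).K Z) ((D (j + 1)).κ Z - t (j + 1) Z) ((D (j + 1)).size Z))
    {k : ℕ} (hk : j₀ ≤ k) (X : (D k).Comp) (hK : (D k).K X = 0) {ε : Type*} (Q : Finset ε) (p m : ε → ℝ) (Wn : ε → ℕ) (bk : ε)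
    {t₀ P P₀ κ₁ F : ℝ} (ht : t₀ + ∑ e ∈ Q, p e ≤ t k X) (hF : F ≤ Real.exp (-(D k).κ X - P))
    (hb : κ₁ * Wn bk + P₀ ≤ P) (he : ∀ e ∈ Q, κ₁ * Wn e + m e ≤ p e) :
    F ≤ Real.exp (-P₀) * Real.exp (-t₀) * Real.exp (-(κ₁ * Wn bk)) * ∏ e ∈ Q, (Real.exp (-(κ₁ * Wn e)) * Real.exp (-m e)) :=
  componentPrice_of_bankedFactor Q (bankedFactor_le_prod_of_history b D t j₀ hbase hstep hk X hK Q p ht hF) hb he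

/-- ★★ **THE EVENT SPLITS ALONG THE FLOW, K-UNIFORMLY** (`T4PersistentHistoryCount.credit_dominates_window` BY NAME): along a run `g 0, …, g K` obeying the typed (2.7) (`B14.FlowIneq27`)
with windows tied to the couplings by the typed (2.5) (`B14.IsRj`), `r ≤ p₀`, event windows per scale `W s ≤ (1+F)·R_s` and ONE γ-clause on the infrared coupling
`L(1+β₀)((1+F)κ₁ + E) ≤ c·A₀·(log g_K⁻²)^{p₀−r}`: every event `e` of a record sitting at a scale `s_e ≤ K`, with window `W_e ≤ W(s_e)` and banked credit `p_e ≥ c·p₀(g_{s_e})` (the credit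
attached to the event's OWN scale — READING (ID): which credit pays which window), satisfies the split `κ₁·W_e + E ≤ p_e`. [bookkeeping] -/
theorem eventCredits_of_flow {ε : Type*} {g : ℕ → ℝ} {R W : ℕ → ℕ} {β' β₀ A₀ c F E κ₁ : ℝ} {L p₀ r K : ℕ}
    (h27 : B14.FlowIneq27 g β' β₀ p₀ K) (hR : ∀ s, s ≤ K → B14.IsRj L r (g s) (R s))
    (hrp : r ≤ p₀) (hL : 1 ≤ L) (hβ : 0 ≤ β₀) (hA : 0 ≤ A₀) (hc : 0 ≤ c) (hE : 0 ≤ E) (hκ : 0 ≤ κ₁)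
    (hx1 : ∀ s, s ≤ K → 1 ≤ Real.log ((g s) ^ 2)⁻¹)
    (hW : ∀ s, s ≤ K → (W s : ℝ) ≤ (1 + F) * R s)
    (hγ : (L : ℝ) * (1 + β₀) * ((1 + F) * κ₁ + E) ≤ c * A₀ * (Real.log ((g K) ^ 2)⁻¹) ^ (p₀ - r))
    (Q : Finset ε) (sc : ε → ℕ) (Wn : ε → ℕ) (p : ε → ℝ) (hsc : ∀ e ∈ Q, sc e ≤ K) (hWn : ∀ e ∈ Q, Wn e ≤ W (sc e))
    (hp : ∀ e ∈ Q, c * p0Profile A₀ p₀ (g (sc e)) ≤ p e) :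
    ∀ e ∈ Q, κ₁ * Wn e + E ≤ p e := by
  intro e he
  have h := credit_dominates_window h27 hR hrp hL hβ hA hc hE hκ hx1 hW hγ (sc e) (hsc e he)
  have hmono : κ₁ * (Wn e : ℝ) ≤ κ₁ * (W (sc e) : ℝ) := mul_le_mul_of_nonneg_left (by exact_mod_cast hWn e he) hκ
  linarith [hp e he]

end Split

/-! ## §4 The per-RECORD price as the fibre sum of per-COMPONENT prices times a multiplicity -/

section Fibre

/-- ★★ **THE FILED STOCK AT ONE SLOT IS THE SUM OVER BIRTH KINDS AND RECORDS OF THE FIBRE SUMS** (the clause `hfile` of `sum_stock_le_twoRate_of_records` with EQUALITY): if every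
candidate `Y` filed at the slot `⟨j, z⟩` has its birth kind in `Bk j` and its record in `records W j K (E j) (kind Y)`, then
`Σ_{Y : slot Y = ⟨j,z⟩} x Y = Σ_{b ∈ Bk j} Σ_{Q ∈ records W j K (E j) b} Σ_{Y : slot Y = ⟨j,z⟩ ∧ kind Y = b ∧ rec Y = Q} x Y` (`Finset.sum_fiberwise_of_maps_to`, twice). [folklore] -/
theorem slotFibre_sum_eq {X γ ε : Type*} [DecidableEq γ] [DecidableEq ε] (Old : Finset X) (slot : X → (Σ _ : ℕ, γ))
    (kind : X → ε) (rec : X → Finset ε) (x : X → ℝ) (W : ε → ℕ) {K : ℕ} (E Bk : ℕ → Finset ε) (j : ℕ) (z : γ)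
    (hkind : ∀ Y ∈ Old, slot Y = ⟨j, z⟩ → kind Y ∈ Bk j) (hrec : ∀ Y ∈ Old, slot Y = ⟨j, z⟩ → rec Y ∈ records W j K (E j) (kind Y)) :
    ∑ Y ∈ Old with slot Y = ⟨j, z⟩, x Y =
      ∑ b ∈ Bk j, ∑ Q ∈ records W j K (E j) b, ∑ Y ∈ Old with (slot Y = ⟨j, z⟩ ∧ kind Y = b ∧ rec Y = Q), x Y := by
  have h1 : ∑ Y ∈ Old with slot Y = ⟨j, z⟩, x Y = ∑ b ∈ Bk j, ∑ Y ∈ (Old.filter fun Y => slot Y = ⟨j, z⟩) with kind Y = b, x Y :=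
    (Finset.sum_fiberwise_of_maps_to (fun Y hY => hkind Y (Finset.mem_filter.1 hY).1 (Finset.mem_filter.1 hY).2) x).symm
  rw [h1]
  refine Finset.sum_congr rfl fun b _ => ?_
  have h2 : ∑ Y ∈ (Old.filter fun Y => slot Y = ⟨j, z⟩) with kind Y = b, x Y =
      ∑ Q ∈ records W j K (E j) b, ∑ Y ∈ ((Old.filter fun Y => slot Y = ⟨j, z⟩).filter fun Y => kind Y = b) with rec Y = Q, x Y := by
    refine (Finset.sum_fiberwise_of_maps_to (fun Y hY => ?_) x).symm
    obtain ⟨hY, hk⟩ := Finset.mem_filter.1 hY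
    obtain ⟨hO, hs⟩ := Finset.mem_filter.1 hY
    rw [← hk]
    exact hrec Y hO hs
  rw [h2]
  refine Finset.sum_congr rfl fun Q _ => ?_
  simp only [Finset.filter_filter, and_assoc]

/-- ★★ **ONE RECORD'S PRICE FROM THE COMPONENTS' PRICES AND A MULTIPLICITY** (the clause `hy` of `sum_stock_le_twoRate_of_records` for the fibre-sum price): if every candidate filed at
`(⟨j,z⟩, b, Q)` is priced `x Y ≤ ρ_b·e^{−κ₁W_b}·Π_{e∈Q}(e^{−κ₁W_e}·μ_e)` (§3's shape; `ρ_b, μ_e ≥ 0`) and at most `n_b·Π_{e∈Q} n_e` candidates are filed there (`n ≥ 0`: the admissible-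
sequence entropy per event — READING (ID)), then the fibre sum is `≤ (n_b·ρ_b)·e^{−κ₁W_b}·Π_{e∈Q}(e^{−κ₁W_e}·(n_e·μ_e))`. [folklore] -/
theorem recordPrice_le_of_componentPrices {X γ ε : Type*} [DecidableEq γ] [DecidableEq ε] (Old : Finset X) (slot : X → (Σ _ : ℕ, γ))
    (kind : X → ε) (rec : X → Finset ε) (x : X → ℝ) (W : ε → ℕ) {κ₁ : ℝ} (ρ μ nB n : ε → ℝ) (j : ℕ) (z : γ) (b : ε) (Q : Finset ε)
    (hρ0 : 0 ≤ ρ b) (hμ0 : ∀ e ∈ Q, 0 ≤ μ e)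
    (hx : ∀ Y ∈ Old, slot Y = ⟨j, z⟩ → kind Y = b → rec Y = Q → x Y ≤ ρ b * Real.exp (-(κ₁ * W b)) * ∏ e ∈ Q, (Real.exp (-(κ₁ * W e)) * μ e))
    (hcard : (((Old.filter fun Y => slot Y = ⟨j, z⟩ ∧ kind Y = b ∧ rec Y = Q).card : ℕ) : ℝ) ≤ nB b * ∏ e ∈ Q, n e) :
    ∑ Y ∈ Old with (slot Y = ⟨j, z⟩ ∧ kind Y = b ∧ rec Y = Q), x Y ≤
      nB b * ρ b * Real.exp (-(κ₁ * W b)) * ∏ e ∈ Q, (Real.exp (-(κ₁ * W e)) * (n e * μ e)) := by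
  set π := ρ b * Real.exp (-(κ₁ * W b)) * ∏ e ∈ Q, (Real.exp (-(κ₁ * W e)) * μ e) with hπ
  have hπ0 : 0 ≤ π := mul_nonneg (mul_nonneg hρ0 (Real.exp_pos _).le) (Finset.prod_nonneg fun e he => mul_nonneg (Real.exp_pos _).le (hμ0 e he))
  have h1 : ∑ Y ∈ Old with (slot Y = ⟨j, z⟩ ∧ kind Y = b ∧ rec Y = Q), x Y ≤ ((Old.filter fun Y => slot Y = ⟨j, z⟩ ∧ kind Y = b ∧ rec Y = Q).card : ℝ) * π := by
    have h := Finset.sum_le_card_nsmul (Old.filter fun Y => slot Y = ⟨j, z⟩ ∧ kind Y = b ∧ rec Y = Q) x π fun Y hY => by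
      obtain ⟨hO, hs, hk, hr⟩ := Finset.mem_filter.1 hY
      exact hx Y hO hs hk hr
    rwa [nsmul_eq_mul] at h
  have h2 : ((Old.filter fun Y => slot Y = ⟨j, z⟩ ∧ kind Y = b ∧ rec Y = Q).card : ℝ) * π ≤ (nB b * ∏ e ∈ Q, n e) * π :=
    mul_le_mul_of_nonneg_right hcard hπ0
  have h3 : (nB b * ∏ e ∈ Q, n e) * π = nB b * ρ b * Real.exp (-(κ₁ * W b)) * ∏ e ∈ Q, (Real.exp (-(κ₁ * W e)) * (n e * μ e)) := by
    rw [hπ, Finset.prod_mul_distrib, Finset.prod_mul_distrib, Finset.prod_mul_distrib]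
    ring
  linarith

end Fibre

/-! ## §5 The stock budget from per-COMPONENT prices -/

section Stock

/-- ★★★ **THE STOCK BUDGET WITH PRINT'S VARIABLE WINDOWS FROM PER-COMPONENT PRICES** (`…N20FinalLevelBankedBudget.sum_stock_le_twoRate_of_records` with its per-record price `y`
INSTANTIATED by the fibre sums and its clauses `hfile ∧ hy` DISCHARGED by §4): the candidates filed under birth slots (`slot`, old: `< j⋆ ≤ K`, cells `#Cell a ≤ V·Λ^a`), birth kinds
(`kind Y ∈ Bk j`) and records (`rec Y ∈ records W j K (E j) (kind Y)`, event universes on `(j, K]`); each candidate priced in §3's shape `x Y ≤ ρ_{kind Y}·e^{−κ₁W_{kind Y}}·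
Π_{e ∈ rec Y}(e^{−κ₁W_e}·μ_e)`; at most `n_b·Π_{e∈Q} n_e` candidates per (slot, kind, record); birth residuals `Σ_{b ∈ Bk j} n_b·ρ_b ≤ ρ̄`, per-step residual entropy
`Σ_{e ∈ E j, step e = τ} n_e·μ_e ≤ η̄` ⇒ `Σ_{Y ∈ Old} x Y ≤ ρ̄e^{−κ₁}·V·(Λσ)^{K − j⋆ + 1}∕(1 − Λσ)`, `σ = e^{η̄−κ₁}`, whenever `Λσ < 1`. [bookkeeping] -/
theorem sum_stock_le_twoRate_of_componentPrices {X γ ε : Type*} [DecidableEq γ] [DecidableEq ε] (Old : Finset X) (slot : X → (Σ _ : ℕ, γ))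
    (kind : X → ε) (rec : X → Finset ε) (x : X → ℝ)
    (Cell : ℕ → Finset γ) {V Λ : ℝ} (hV : 0 ≤ V) (hΛ : 0 ≤ Λ) (hcell : ∀ a, ((Cell a).card : ℝ) ≤ V * Λ ^ a)
    (W : ε → ℕ) (step : ε → ℕ) {K : ℕ} (E Bk : ℕ → Finset ε) (hE : ∀ j, ∀ e ∈ E j, step e ∈ Ioc j K) {κ₁ ρbar ηbar : ℝ} (hκ : 0 ≤ κ₁)
    (ρ nB : ε → ℝ) (hρ : ∀ j, ∀ b ∈ Bk j, 0 ≤ ρ b) (hnB : ∀ j, ∀ b ∈ Bk j, 0 ≤ nB b) (hρbar : ∀ j, ∑ b ∈ Bk j, nB b * ρ b ≤ ρbar)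
    (μ n : ε → ℝ) (hμ : ∀ j, ∀ e ∈ E j, 0 ≤ μ e) (hn : ∀ j, ∀ e ∈ E j, 0 ≤ n e)
    (hηbar : ∀ j, ∀ τ ∈ Ioc j K, ∑ e ∈ E j with step e = τ, n e * μ e ≤ ηbar) (hr : Λ * Real.exp (ηbar - κ₁) < 1)
    {jstar : ℕ} (hj : jstar ≤ K) (hold : ∀ Y ∈ Old, (slot Y).1 < jstar) (hmem : ∀ Y ∈ Old, (slot Y).2 ∈ Cell (K - (slot Y).1))
    (hkind : ∀ Y ∈ Old, kind Y ∈ Bk (slot Y).1) (hrec : ∀ Y ∈ Old, rec Y ∈ records W (slot Y).1 K (E (slot Y).1) (kind Y))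
    (hx : ∀ Y ∈ Old, x Y ≤ ρ (kind Y) * Real.exp (-(κ₁ * W (kind Y))) * ∏ e ∈ rec Y, (Real.exp (-(κ₁ * W e)) * μ e))
    (hcard : ∀ j < jstar, ∀ z ∈ Cell (K - j), ∀ b ∈ Bk j, ∀ Q ∈ records W j K (E j) b,
      (((Old.filter fun Y => slot Y = ⟨j, z⟩ ∧ kind Y = b ∧ rec Y = Q).card : ℕ) : ℝ) ≤ nB b * ∏ e ∈ Q, n e) :
    ∑ Y ∈ Old, x Y ≤ ρbar * Real.exp (-κ₁) * V * ((Λ * Real.exp (ηbar - κ₁)) ^ (K - jstar + 1) / (1 - Λ * Real.exp (ηbar - κ₁))) := by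
  refine sum_stock_le_twoRate_of_records Old slot x Cell hV hΛ hcell W step E Bk hE hκ (fun b => nB b * ρ b)
    (fun j b hb => mul_nonneg (hnB j b hb) (hρ j b hb)) hρbar (fun e => n e * μ e) (fun j e he => mul_nonneg (hn j e he) (hμ j e he)) hηbar hr hj hold hmem
    (fun j z b Q => ∑ Y ∈ Old with (slot Y = ⟨j, z⟩ ∧ kind Y = b ∧ rec Y = Q), x Y) (fun j _ z _ => le_of_eq ?_) (fun j _ z _ b hb Q hQ => ?_)
  · exact slotFibre_sum_eq Old slot kind rec x W E Bk j z (fun Y hY hs => by have h := hkind Y hY; rwa [hs] at h)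
      (fun Y hY hs => by have h := hrec Y hY; rwa [hs] at h)
  · have hQE : Q ⊆ E j := (mem_records.1 hQ).1
    exact recordPrice_le_of_componentPrices Old slot kind rec x W ρ μ nB n j z b Q (hρ j b hb) (fun e he => hμ j e (hQE he))
      (fun Y hY hs hk hrY => by have h := hx Y hY; rwa [hk, hrY] at h) (hcard j ‹_› z ‹_› b hb Q hQ)

end Stock

/-! ## §6 Non-vacuity -/

section Toy

/-- ★ **NON-VACUITY OF THE PER-COMPONENT PRICE.**  One component at its horizon with budget `κ = 6`, size term `t₀ = 1`, a record of ONE event `e = 0` with banked credit `p_e = 3` ((1.80)⁺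
at `K = 0`: `1 + 3 ≤ 6`), window `W_e = 1`, `κ₁ = 2`, margin `m_e = 1` (`2·1 + 1 ≤ 3`), birth term `P = 4` with birth window `W_b = 1` and residual `P₀ = 2` (`2·1 + 2 ≤ 4`): any factor
`F ≤ exp(−6 − 4)` is priced `≤ (e^{−2}e^{−1})·e^{−2·1}·(e^{−2·1}·e^{−1})` — birth residual, size, birth window, event window and event margin all visible. [bookkeeping] -/
theorem toy_componentPrice {F : ℝ} (hF : F ≤ Real.exp (-6 - 4)) :
    let b : Budget.Consts := ⟨1, 1, 1, fun _ => 1⟩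
    Controls b 5 0 (6 - (1 + ∑ e ∈ ({0} : Finset ℕ), (fun _ => (3 : ℝ)) e)) (fun _ => 1) ∧
      F ≤ Real.exp (-2) * Real.exp (-1) * Real.exp (-(2 * ((fun _ : ℕ => (1 : ℕ)) 0 : ℕ))) *
        ∏ e ∈ ({0} : Finset ℕ), (Real.exp (-(2 * ((fun _ : ℕ => (1 : ℕ)) e : ℕ))) * Real.exp (-(fun _ : ℕ => (1 : ℝ)) e)) := by
  intro b
  have hC : Controls b 5 0 (6 - (1 + ∑ e ∈ ({0} : Finset ℕ), (fun _ => (3 : ℝ)) e)) (fun _ => 1) := by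
    rw [controlsT_zero_iff, Finset.sum_singleton]
    norm_num
  refine ⟨hC, ?_⟩
  exact componentPrice_of_bankedFactor (P := 4) (P₀ := 2) (κ₁ := 2) (m := fun _ : ℕ => (1 : ℝ)) (Wn := fun _ : ℕ => (1 : ℕ)) (bk := 0)
    ({0} : Finset ℕ) (bankedFactor_le_prod b 5 {0} (fun _ => (3 : ℝ)) (fun _ => 1) hC hF) (by norm_num) (fun e _ => by norm_num)

end Toy

end YMDAG.UVSplit
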